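import Literature.AlgebraicGeometry.GroupSchemes.FrobeniusKernelAlongMonoHom
import Literature.AlgebraicGeometry.GroupSchemes.FrobeniusKernelOfIdealPowerTorsion
import HarnessLib

/-!
# The Frobenius kernel of an abelian variety ALONG A CLOSED SUBGROUP `ι : G₀ ↪ A`, in the spine's base-change currency
# «`t ≫ ι ≫ F^{(f)}_{A∕k} = 1` in `A^{(q)} = A ×_{k,Frob^f} k` ⟺ `t` killed by `F_{G₀}` ⟺ `t ∈ Spec (Γ(G₀) ⧸ ker Γ(ι_{Ker F_{G₀}}))`»
# ([SGA3I] VII_A 4.1; [GortzWedhorn2020] Def. 4.45 (2), Section (4.7); [Waterhouse1979] §2.1)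

Topic `Literature/AlgebraicGeometry/AbelianSchemes`; namespace `Literature.AlgebraicGeometry.AbelianSchemes.AbelianSchemeOver` (continues ★
`GroupSchemes/FrobeniusKernelAlongMonoHom` (the same two statements for ANY ambient group scheme `X`, with the trivial point of the twist in ★
`frobeniusTwistOver` currency) and ★ `GroupSchemes/FrobeniusKernelOfIdealPowerTorsion` §3 (`one_hom_frobeniusTwistOver_eq`: the two currencies of
the trivial point of `A^{(q)}` agree by `rfl`)).  THEOREMS ONLY (no definition, no named fact, no instance, no notation, no `sorry`).  Cell
`hodgecm-mathlib` (D-0151), P6 «MOD programme» (crux hLiu418 = stmt-HodgeConjecture-24832, `--supports`, count-neutral), half-A line L3 (socket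
`stub_ROOF0`, (R3) `c•w` kernel reading; LA3-plan (g2) deal (hF) «DOCK FROBENIUS LAW» 2026-09-02T06:57:17Z): the binder `hF` of the (R3) glue
`hlaw_cw_of_dockClauses` is stated with `(1 : T ⟶ (A.baseChange (frobSpec k p f)).X)` (the spine's presentation of `A^{(q)}`, as in ★ (FKw)
`FrobeniusKernelLawBlockAssembly`), and at the dock `A := A_x̄` is a LARGE closed term: rewriting the currency there costs 8·10⁶ heartbeats (measured),
while instantiating a lemma already stated in base-change currency at a VARIABLE `A` costs 5·10⁴.  Hence this file: the currency change is done once,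
generically (13k heartbeats), and the S-glue is ONE `exact`.  HONEST LABEL: HC_CM is proved only modulo the 2 remaining named inputs (hLiu418 24832,
h413 24833) until rung 0 closes; this file is generic and discharges none of them.

THE MATHEMATICS.  `k` a field of exponential characteristic `p`, `q = p^f`, `A∕k` an abelian scheme, `ι : G₀ → A` a homomorphism of `k`-group schemes
with `ι.left` a monomorphism (a closed subgroup).  The relative `q`-Frobenius `F^{(f)}_{A∕k} : A → A^{(q)}` has target the base change `A ×_{k,Frob^f} k`
([GortzWedhorn2020] Section (4.7)); its trivial `T`-point in the two presentations of the tree agrees definitionally (★ `one_hom_frobeniusTwistOver_eq`).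
§1: for a `T`-point `t` of `G₀`, `t ≫ ι ≫ F_A = 1 ⟺ t ≫ F_{G₀} = 1` (naturality of the relative Frobenius and `e_A = e_{G₀} ≫ ι`; [SGA3I] VII_A 4.1;
★ `comp_comp_relFrobeniusOver_eq_one_iff_comp_relFrobeniusOver_eq_one`).  §2 HEAD: for `G₀` moreover affine and finite, `⟺ t` factors through the closed
subscheme `Spec (Γ(G₀) ⧸ 𝔎) ↪ G₀`, `𝔎 = ker Γ(ι_{Ker F_{G₀}})` the ideal of the Frobenius kernel ([Waterhouse1979] §2.1; ★
`comp_comp_relFrobeniusOver_eq_one_iff_exists_comp_quotIncl`).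

* §1 `subgroup_comp_relFrobeniusOver_eq_one_iff`;
* §2 HEAD **`subgroup_comp_relFrobeniusOver_eq_one_iff_exists_comp_quotIncl`**.

## References
* [SGA3I] M. Demazure, A. Grothendieck, *SGA 3* I, Exp. VII_A (P. Gabriel), 4.1.
* [GortzWedhorn2020] U. Görtz, T. Wedhorn, *Algebraic Geometry I*, 2nd ed. (2020), Def. 4.45 (2) (p. 117), Section (4.7).
* [Waterhouse1979] W. C. Waterhouse, *Introduction to Affine Group Schemes*, GTM 66 (1979), §2.1.
-/

set_option autoImplicit false

-- Mathlib's `Over`/`Scheme` APIs are stated across semireducible wrappers (as in the ★ `GroupSchemes/*` files).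
set_option backward.isDefEq.respectTransparency false

-- As in ★ `FrobeniusKernelAlongMonoHom`: statements of the shape `c ≫ F^t = 1` need the slow `One (T ⟶ G^{(p^t)})` instance search.
set_option synthInstance.maxHeartbeats 200000

noncomputable section

universe u

open CategoryTheory CategoryTheory.Limits AlgebraicGeometry MonoidalCategory CartesianMonoidalCategory
open scoped MonObj Obj

namespace Literature.AlgebraicGeometry.AbelianSchemes.AbelianSchemeOver

open Literature.AlgebraicGeometry.Motives
open Literature.AlgebraicGeometry.GroupSchemes Literature.AlgebraicGeometry.GroupSchemes.GroupSchemeKernel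
  Literature.AlgebraicGeometry.GroupSchemes.AffineGroupScheme

variable {k : Type u} [Field k] (p : ℕ) [ExpChar k p] (f : ℕ) (A : AbelianSchemeOver (Spec (.of k)))
  {G₀ : SchemeOver k} [GrpObj G₀] (jG : G₀ ⟶ A.X) [IsMonHom jG] [Mono jG.left]

/-! ## §1 `t ≫ ι` killed by `F_A` (base-change currency) iff `t` killed by `F_{G₀}` -/

/-- **THE FROBENIUS KERNEL OF AN ABELIAN VARIETY ALONG A CLOSED SUBGROUP, §1**: for `ι : G₀ → A` a homomorphism with `ι.left` mono and a `T`-point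
`t` of `G₀`, `t ≫ ι ≫ F^{(f)}_{A∕k} = 1` — the trivial point of `A^{(q)}` written in the spine's base-change presentation `A ×_{k,Frob^f} k` — iff
`t ≫ F^{(f)}_{G₀∕k} = 1`.  The currency is changed at the VARIABLE `A` (★ `one_hom_frobeniusTwistOver_eq`, `rfl`) and the statement is then ★
`comp_comp_relFrobeniusOver_eq_one_iff_comp_relFrobeniusOver_eq_one`. [cite: SGA3I, VII_A 4.1] [cite: GortzWedhorn2020, Def. 4.45 (2) (p. 117)]
[cite: GortzWedhorn2020, Section (4.7)] -/
theorem subgroup_comp_relFrobeniusOver_eq_one_iff {T : SchemeOver k} (t : T ⟶ G₀) :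
    t ≫ jG ≫ relFrobeniusOver p f A.X = (1 : T ⟶ (A.baseChange (frobSpec k p f)).X) ↔ t ≫ relFrobeniusOver p f G₀ = 1 := by
  rw [← one_hom_frobeniusTwistOver_eq p f A T, ← Category.assoc]
  exact comp_comp_relFrobeniusOver_eq_one_iff_comp_relFrobeniusOver_eq_one p f jG t

/-! ## §2 The head: `t ≫ ι` killed by `F_A` iff `t` factors through `Spec (Γ(G₀) ⧸ ker Γ(ι_{Ker F_{G₀}}))` -/

/-- **THE FROBENIUS KERNEL OF AN ABELIAN VARIETY ALONG A CLOSED SUBGROUP (head)** — for `ι : G₀ → A` a homomorphism of `k`-group schemes with `ι.left`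
mono, `G₀` affine and finite, and a `T`-point `t` of `G₀`: `t ≫ ι ≫ F^{(f)}_{A∕k} = 1` (base-change currency) `↔ ∃ s, s ≫ quotIncl G₀ (ker Γ(ι_{Ker
F^{(f)}_{G₀}})) = t`.  The currency is changed at the VARIABLE `A` (★ `one_hom_frobeniusTwistOver_eq`) and the statement is then ★
`comp_comp_relFrobeniusOver_eq_one_iff_exists_comp_quotIncl`; at the P6 dock (`ι := ι₀G`, `A := A_x̄`, the ideal `= kerFI p f G₀` by `rfl`) the S-glue is
ONE `exact` of this lemma (5·10⁴ heartbeats, against 8·10⁶ for rewriting the currency at `A_x̄`). [cite: SGA3I, VII_A 4.1] [cite: Waterhouse1979, §2.1]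
[cite: GortzWedhorn2020, Def. 4.45 (2) (p. 117)] -/
theorem subgroup_comp_relFrobeniusOver_eq_one_iff_exists_comp_quotIncl [IsAffine G₀.left] [IsFinite G₀.hom]
    {T : SchemeOver k} (t : T ⟶ G₀) :
    t ≫ jG ≫ relFrobeniusOver p f A.X = (1 : T ⟶ (A.baseChange (frobSpec k p f)).X) ↔
      ∃ s : T ⟶ _, s ≫ quotIncl G₀ (RingHom.ker (kerι (relFrobeniusOver p f G₀)).left.appTop.hom : Ideal (Alg G₀)) = t := by
  rw [← one_hom_frobeniusTwistOver_eq p f A T, ← Category.assoc]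
  exact comp_comp_relFrobeniusOver_eq_one_iff_exists_comp_quotIncl p f jG t

end Literature.AlgebraicGeometry.AbelianSchemes.AbelianSchemeOver

end
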